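import Mathlib.RingTheory.IsTensorProduct
import Mathlib.RingTheory.TensorProduct.Free
import Mathlib.LinearAlgebra.FreeModule.Basic
import Literature.AlgebraicGeometry.Motives.MumfordTateInvariantsTensorBasis
import Literature.AlgebraicGeometry.Motives.MumfordTateInvariants
import HarnessLib

/-!
# Extension of scalars for the tensor spaces `T^{a,b}` and for Mumford–Tate invariants

For a finite-dimensional `ℚ`-vector space `V` and ANY field `K ⊇ ℚ` (not only `K = ℂ`), the
comparison map `ι = tensorSpaceToBaseChange K V a b : T^{a,b} V → T^{a,b}_K (K ⊗_ℚ V)` of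
`EtaleTate.lean` exhibits `T^{a,b}_K (K ⊗ V)` as the base change `K ⊗_ℚ T^{a,b} V`
(`isBaseChange_tensorSpaceToBaseChange`: it maps the tensor basis of a basis `e` of `V` to the
tensor basis of the basis `1 ⊗ e` of `K ⊗ V`). We then prove the principle
**"invariants commute with extension of scalars"**: for a base change `j : M → N` along a field
extension `k → K` and families of `k`-linear operators `Lᵢ, Rᵢ` on `M` with `K`-linear extensions
`L'ᵢ, R'ᵢ` on `N`, the joint equaliser `{y | ∀ i, L'ᵢ y = R'ᵢ y}` is the `K`-span of the image of
the joint equaliser of the `Lᵢ, Rᵢ` (`mem_span_image_of_forall_of_isBaseChange`; proof: expand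
along a `k`-basis of `K`), and
deduce the first half of the named fact `Deligne1982_mumfordTateInvariants_baseChange` from the
rational statement `Deligne1982_mumfordTateInvariants` (hypothesis `h`): a weight-`0` tensor in
`T^{a,b}_K (K ⊗ V)` fixed by `MT(H)(K)` is in particular fixed by the base changes `1 ⊗ g`,
`g ∈ MT(H)(ℚ)`, hence lies in the `K`-span of the base-changed `MT(H)(ℚ)`-invariants, which are
the Hodge classes of type `(0,0)` (`mem_span_of_forall_mumfordTateGroupBaseChange_of_rational`).
This is the argument "`(K ⊗ T)^{G} = K ⊗ T^{G}`" of Deligne, *Hodge cycles on abelian varieties*,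
LNM 900, I §3 (proof of Prop. 3.1 and 3.4 work over any field of characteristic `0`), for the
group of rational points.

## References

* P. Deligne, *Hodge cycles on abelian varieties* (notes by J. S. Milne), LNM 900 (1982), I §3,
  Prop. 3.1, 3.4.

## Design

Theorems and no new named facts (D-0026). `namespace Literature.AlgebraicGeometry.Motives`.
-/

noncomputable section

open scoped TensorProduct PiTensorProduct

namespace Literature.AlgebraicGeometry.Motives

universe u v w

/-! ### Base change recognised on bases; invariants commute with extension of scalars -/

section Generic

/- The instance hypotheses below deliberately match those of Mathlib's `IsBaseChange`
(`CommSemiring`, `AddCommMonoid`): stronger ones (`Field`, `AddCommGroup`) make the elaborator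
unfold the tensor-product structures when the lemmas are applied to `T^{a,b}` (timeouts). -/
variable {k : Type u} {K : Type v}
  {M : Type w} [AddCommMonoid M] {N : Type*} [AddCommMonoid N]

/-- **Base change recognised on bases**: a `k`-linear map `f : M → N` into a `K`-module sending a
`k`-basis of `M` to a `K`-basis of `N` is a base change along `k → K`. [folklore] -/
theorem isBaseChange_of_basis [CommSemiring k] [CommSemiring K] [Algebra k K] [Module k M]
    [Module k N] [Module K N] [IsScalarTower k K N] {ι : Type*} (f : M →ₗ[k] N) (b : Module.Basis ι k M)
    (b' : Module.Basis ι K N) (hf : ∀ i, f (b i) = b' i) : IsBaseChange K f := by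
  refine IsBaseChange.of_equiv ((Algebra.TensorProduct.basis K b).equiv b' (Equiv.refl ι))
    fun x => ?_
  suffices h : (((Algebra.TensorProduct.basis K b).equiv b' (Equiv.refl ι)).toLinearMap.restrictScalars
      k) ∘ₗ TensorProduct.mk k K M 1 = f from LinearMap.congr_fun h x
  refine b.ext fun i => ?_
  simp only [LinearMap.coe_comp, LinearMap.coe_restrictScalars, Function.comp_apply,
    TensorProduct.mk_apply, LinearEquiv.coe_coe, hf]
  rw [← Algebra.TensorProduct.basis_apply, Module.Basis.equiv_apply, Equiv.refl_apply]

/-- **Invariants commute with extension of scalars.** Let `j : M → N` be a base change along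
`k → K` (`k` a field), `Lᵢ, Rᵢ` two families of `k`-linear operators on `M` and `L'ᵢ, R'ᵢ`
`K`-linear operators on `N` extending them (`L'ᵢ ∘ j = j ∘ Lᵢ`, `R'ᵢ ∘ j = j ∘ Rᵢ`). Then every
`y ∈ N` with `L'ᵢ y = R'ᵢ y` for all `i` lies in the `K`-span of the image of the joint equaliser
`{x | ∀ i, Lᵢ x = Rᵢ x}` (expand `y` along a `k`-basis of `K`: the coefficients are equalised).
Applied to `Lᵢ = ρ(gᵢ)`, `Rᵢ = 1` this is `(K ⊗ T)^G = K ⊗ T^G` (Deligne, LNM 900, I §3).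
(Equalisers rather than kernels: no subtraction is needed on `N`.) [folklore] -/
theorem mem_span_image_of_forall_of_isBaseChange [Field k] [CommRing K] [Algebra k K] [Module k M]
    [Module k N] [Module K N] [IsScalarTower k K N] {j : M →ₗ[k] N} (hj : IsBaseChange K j)
    {ι' : Type*} (L R : ι' → M →ₗ[k] M) (L' R' : ι' → N →ₗ[K] N)
    (hL : ∀ i x, L' i (j x) = j (L i x)) (hR : ∀ i x, R' i (j x) = j (R i x)) {y : N}
    (hy : ∀ i, L' i y = R' i y) :
    y ∈ Submodule.span K (j '' {x | ∀ i, L i x = R i x}) := by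
  classical
  -- naturality of the identification `K ⊗ M ≃ N`
  have hnat : ∀ (F : M →ₗ[k] M) (F' : N →ₗ[K] N), (∀ x, F' (j x) = j (F x)) →
      ∀ z : K ⊗[k] M, hj.equiv (F.baseChange K z) = F' (hj.equiv z) := by
    intro F F' hF z
    induction z using TensorProduct.induction_on with
    | zero => simp
    | tmul c m => rw [LinearMap.baseChange_tmul, hj.equiv_tmul, hj.equiv_tmul, map_smul, hF]
    | add z w hz hw => rw [map_add, map_add, hz, hw, map_add, map_add]
  set z := hj.equiv.symm y with hz
  have hz0 : ∀ i, (L i).baseChange K z = (R i).baseChange K z := fun i =>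
    hj.equiv.injective (by rw [hnat _ _ (hL i), hnat _ _ (hR i), hz,
      LinearEquiv.apply_symm_apply, hy])
  -- coefficients of `z` along a `k`-basis `κ` of `K`
  let κ := Module.Free.chooseBasis k K
  have key : ∀ (F : M →ₗ[k] M) (w : K ⊗[k] M),
      TensorProduct.equivFinsuppOfBasisLeft κ (F.baseChange K w) =
      (TensorProduct.equivFinsuppOfBasisLeft κ w).mapRange F (map_zero _) := by
    intro F w
    induction w using TensorProduct.induction_on with
    | zero => simp
    | tmul c m =>
      rw [LinearMap.baseChange_tmul, TensorProduct.equivFinsuppOfBasisLeft_apply_tmul,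
        TensorProduct.equivFinsuppOfBasisLeft_apply_tmul]
      ext α
      simp
    | add z w hz hw =>
      rw [map_add, map_add, hz, hw, map_add, Finsupp.mapRange_add (map_add _)]
  set c := TensorProduct.equivFinsuppOfBasisLeft κ z with hc
  have hmem : ∀ α, c α ∈ {x : M | ∀ i, L i x = R i x} := by
    intro α i
    have h1 := key (L i) z
    rw [hz0, key (R i) z] at h1
    simpa using (DFunLike.congr_fun h1 α).symm
  -- reconstruct `y = Σ κ_α • j (c α)`
  have hzsum : z = c.sum fun α m => κ α ⊗ₜ[k] m := by
    rw [hc, ← TensorProduct.equivFinsuppOfBasisLeft_symm_apply, LinearEquiv.symm_apply_apply]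
  have hy' : y = c.sum fun α m => κ α • j m := by
    conv_lhs => rw [← hj.equiv.apply_symm_apply y, ← hz, hzsum, map_finsuppSum]
    simp [hj.equiv_tmul]
  rw [hy']
  exact Submodule.sum_mem _ fun α _ =>
    Submodule.smul_mem _ _ (Submodule.subset_span ⟨c α, hmem α, rfl⟩)

/-- The equality form: the joint equaliser of the `L'ᵢ, R'ᵢ` IS the `K`-span of the image of the
joint equaliser of the `Lᵢ, Rᵢ`. [folklore] -/
theorem setOf_forall_eq_span_image_of_isBaseChange [Field k] [CommRing K] [Algebra k K]
    [Module k M] [Module k N] [Module K N] [IsScalarTower k K N] {j : M →ₗ[k] N}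
    (hj : IsBaseChange K j) {ι' : Type*} (L R : ι' → M →ₗ[k] M) (L' R' : ι' → N →ₗ[K] N)
    (hL : ∀ i x, L' i (j x) = j (L i x)) (hR : ∀ i x, R' i (j x) = j (R i x)) :
    {y : N | ∀ i, L' i y = R' i y} = Submodule.span K (j '' {x | ∀ i, L i x = R i x}) := by
  refine Set.Subset.antisymm
    (fun y hy => mem_span_image_of_forall_of_isBaseChange hj L R L' R' hL hR hy) ?_
  have h : Submodule.span K (j '' {x | ∀ i, L i x = R i x}) ≤
      ⨅ i, LinearMap.eqLocus (L' i) (R' i) := by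
    rw [Submodule.span_le]
    rintro _ ⟨x, hx, rfl⟩
    simp only [SetLike.mem_coe, Submodule.mem_iInf, LinearMap.mem_eqLocus]
    intro i
    rw [hL, hR, hx i]
  intro y hy i
  exact LinearMap.mem_eqLocus.1 ((Submodule.mem_iInf _).1 (h hy) i)

end Generic

/-! ### `T^{a,b}_K (K ⊗ V)` is the base change of `T^{a,b} V` -/

section TensorSpaces

variable (K : Type u) [Field K] [Algebra ℚ K] (V : Type v) [AddCommGroup V] [Module ℚ V]

/-- The dual basis of the base-changed basis `1 ⊗ e` consists of the base changes of the dual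
basis vectors. [folklore] -/
theorem dualBasis_baseChange {ι : Type w} [Fintype ι] [DecidableEq ι] (e : Module.Basis ι ℚ V)
    (i : ι) :
    Module.Dual.baseChange K (e.dualBasis i) = (Algebra.TensorProduct.basis K e).dualBasis i := by
  refine (Algebra.TensorProduct.basis K e).ext fun l => ?_
  rw [Module.Basis.dualBasis_apply_self, Algebra.TensorProduct.basis_apply,
    Module.Dual.baseChange_apply_tmul, Module.Basis.dualBasis_apply_self]
  split_ifs <;> simp

/-- **The comparison map sends tensor bases to tensor bases**: `ι` maps the tensor basis of
`T^{a,b} V` attached to a basis `e` of `V` to the tensor basis of `T^{a,b}_K (K ⊗ V)` attached to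
the basis `1 ⊗ e`. [folklore] -/
theorem tensorSpaceToBaseChange_hodgeTensorBasis {ι : Type w} [Fintype ι] [DecidableEq ι]
    (e : Module.Basis ι ℚ V) (a b : ℕ) (x : (Fin a → ι) × (Fin b → ι)) :
    tensorSpaceToBaseChange K V a b (hodgeTensorBasis e a b x) =
      hodgeTensorBasis (Algebra.TensorProduct.basis K e) a b x := by
  obtain ⟨β, γ⟩ := x
  rw [hodgeTensorBasis_apply, hodgeTensorBasis_apply, tensorSpaceToBaseChange_tprod_tmul_tprod]
  simp only [Algebra.TensorProduct.basis_apply, dualBasis_baseChange]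

variable [Module.Finite ℚ V]

/-- **`T^{a,b}_K (K ⊗_ℚ V)` is the extension of scalars `K ⊗_ℚ T^{a,b} V`** along the comparison
map `ι = tensorSpaceToBaseChange K V a b`, for `V` finite-dimensional and any field `K ⊇ ℚ`
(Deligne, LNM 900, I §3.1: the tensor construction `T^{a,b}` commutes with extension of
scalars). [folklore] -/
theorem isBaseChange_tensorSpaceToBaseChange (a b : ℕ) :
    IsBaseChange K (tensorSpaceToBaseChange K V a b) :=
  isBaseChange_of_basis _ (hodgeTensorBasis (Module.finBasis ℚ V) a b)
    (hodgeTensorBasis (Algebra.TensorProduct.basis K (Module.finBasis ℚ V)) a b)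
    (tensorSpaceToBaseChange_hodgeTensorBasis K V _ a b)

/-- The `ι t`, `t ∈ T^{a,b} V`, span `T^{a,b}_K (K ⊗ V)` over `K`. [folklore] -/
theorem span_range_tensorSpaceToBaseChange (a b : ℕ) :
    Submodule.span K (Set.range (tensorSpaceToBaseChange K V a b)) = ⊤ := by
  rw [eq_top_iff]
  rintro s -
  obtain ⟨z, rfl⟩ := (isBaseChange_tensorSpaceToBaseChange K V a b).equiv.surjective s
  induction z using TensorProduct.induction_on with
  | zero => simp
  | tmul c t =>
    rw [IsBaseChange.equiv_tmul]
    exact Submodule.smul_mem _ _ (Submodule.subset_span ⟨t, rfl⟩)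
  | add z w hz hw =>
    rw [map_add]
    exact Submodule.add_mem _ hz hw

/-- Two `K`-linear maps out of `T^{a,b}_K (K ⊗ V)` agreeing on the `ι t` are equal. [folklore] -/
theorem linearMap_ext_tensorSpaceToBaseChange {a b : ℕ} {Q : Type*} [AddCommGroup Q] [Module K Q]
    {f g : hodgeTensorSpaceOver K (K ⊗[ℚ] V) a b →ₗ[K] Q}
    (h : ∀ t, f (tensorSpaceToBaseChange K V a b t) = g (tensorSpaceToBaseChange K V a b t)) :
    f = g :=
  (isBaseChange_tensorSpaceToBaseChange K V a b).algHom_ext f g h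

end TensorSpaces

/-! ### Mumford–Tate invariants over `K` from the rational statement -/

namespace HodgeStructure

variable (K : Type w) [Field K] [Algebra ℚ K]
  {V : Type u} [AddCommGroup V] [Module ℚ V] [Module.Finite ℚ V] [HodgeTensorFacts.{u, u}] {n : ℤ}

/-- **Invariants of `MT(H)(ℚ)` commute with extension of scalars**: a tensor
`s ∈ T^{a,b}_K (K ⊗ V)` fixed by the base changes `1 ⊗ g` of all `g ∈ MT(H)(ℚ)` lies in the
`K`-span of the `ι t`, `t ∈ T^{a,b} V` fixed by `MT(H)(ℚ)` (`(K ⊗ T)^G = K ⊗ T^G`, Deligne,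
LNM 900, I §3). No polarization is needed. [folklore] -/
theorem mem_span_image_fixed_of_forall_glBaseChange (H : HodgeStructure V n) {a b : ℕ}
    {s : hodgeTensorSpaceOver K (K ⊗[ℚ] V) a b}
    (hs : ∀ g ∈ H.mumfordTateGroup, tensorSpaceActOver (glBaseChange K V g) s = s) :
    s ∈ Submodule.span K (tensorSpaceToBaseChange K V a b ''
      {t | ∀ g ∈ H.mumfordTateGroup, tensorSpaceAct g t = t}) := by
  -- the operators `ρ(g)`, `g ∈ MT(H)(ℚ)`, their extensions `ρ_K(1 ⊗ g)`, equalised with `1`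
  have key := mem_span_image_of_forall_of_isBaseChange
    (isBaseChange_tensorSpaceToBaseChange K V a b) (ι' := H.mumfordTateGroup)
    (fun g => (tensorSpaceAct (a := a) (b := b) (g : V ≃ₗ[ℚ] V)).toLinearMap)
    (fun _ => LinearMap.id)
    (fun g => (tensorSpaceActOver (a := a) (b := b) ((g : V ≃ₗ[ℚ] V).baseChange ℚ K V V)).toLinearMap)
    (fun _ => LinearMap.id)
    (fun g t => by simp [tensorSpaceToBaseChange_tensorSpaceAct]) (fun _ _ => rfl) (y := s)
    (fun g => by simpa using hs g g.2)
  have hset : {t : hodgeTensorSpace V a b | ∀ g : H.mumfordTateGroup,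
      (tensorSpaceAct (a := a) (b := b) (g : V ≃ₗ[ℚ] V)).toLinearMap t =
        (LinearMap.id : hodgeTensorSpace V a b →ₗ[ℚ] _) t} =
      {t | ∀ g ∈ H.mumfordTateGroup, tensorSpaceAct g t = t} := by
    ext t
    simp only [Set.mem_setOf_eq, LinearEquiv.coe_coe, LinearMap.id_coe, id_eq, Subtype.forall]
  rwa [hset] at key

/-- **Part (i) of `Deligne1982_mumfordTateInvariants_baseChange` from the rational statement.**
Under `Deligne1982_mumfordTateInvariants` (hypothesis `h`), for a polarizable `H`, any field
`K ⊇ ℚ` and `(a - b) n = 0`: a tensor `s ∈ T^{a,b}_K (K ⊗ V)` fixed by `MT(H)(K)` lies in the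
`K`-span of the base changes of the rational Hodge classes of type `(0,0)`. Proof: `s` is fixed by
the `1 ⊗ g`, `g ∈ MT(H)(ℚ)` (`mumfordTateGroup_le_comap`), hence lies in the `K`-span of the
base-changed `MT(H)(ℚ)`-invariants (`mem_span_image_fixed_of_forall_glBaseChange`), and these
invariants are Hodge classes of type `(0,0)` by the rational statement (Deligne, LNM 900, I
Prop. 3.4 with its proof; "invariants commute with flat base change").
[cite: Deligne1982HodgeCycles, I Prop. 3.4 (with proof)] -/
theorem mem_span_of_forall_mumfordTateGroupBaseChange_of_rational
    (h : Deligne1982_mumfordTateInvariants.{u}) (H : HodgeStructure V n) (hH : H.IsPolarizable)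
    {a b : ℕ} (hab : ((a : ℤ) - b) * n = 0) (s : hodgeTensorSpaceOver K (K ⊗[ℚ] V) a b)
    (hs : ∀ γ ∈ H.mumfordTateGroupBaseChange K, tensorSpaceActOver γ s = s) :
    s ∈ Submodule.span K
      (tensorSpaceToBaseChange K V a b '' ((H.tensorSpace a b).hodgeClasses 0 : Set _)) := by
  have h1 := H.mem_span_image_fixed_of_forall_glBaseChange K
    (fun g hg => hs _ (mumfordTateGroup_le_comap K H hg))
  refine Submodule.span_mono (Set.image_mono fun t ht => ?_) h1
  exact (h H hH).1 a b hab t ht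

end HodgeStructure

end Literature.AlgebraicGeometry.Motives

end
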